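import Summits.RiemannHypothesis.RiemannHypothesis.Theorems.PfPersistenceCoefficientRigidityFiniteSites
import HarnessLib

/-!
# Coefficient rigidity of window positivity, IV-c: every Euler-factor deletion, no threshold
(pub-rhpf cand-7, gen 9; mechanism/rigidity campaign; no RH claims)

Part II (`PfPersistenceCoefficientRigidityDeletion`) proved that deleting the Euler factor of a
prime `p ≥ N₀` (truncated at any `p^K`, `K ≥ 1`) from `ζ`'s explicit formula gives a non-positive
functional, with an inexplicit threshold `N₀` coming from the hairline.  The tower functional is a
special case of the finitely-many-sites functional of part IV-b (sites `(k+1)·x₀`, `k < K`), so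
part IV-b removes the threshold: EVERY prime, every truncation.  ALL STATEMENTS ARE PROVED
(no `sorry`, no new axioms; RH only inside part IV-b's `by_cases`); no sentence here is DATA.

* `exists_towerQuadratic_neg` — `x₀ > 0`, some `μ_k ≠ 0` (`k < K`) ⇒ `∃` test `g` with
  `Re tower_{μ,K,x₀}(g ⋆ g̃) < 0`.
* `towerQuadratic_nonneg_iff` — positivity of the tower family `↔ ((∀ k < K, μ_k = 0) ∧ RH)`
  (RH via the imported Weil criterion; not claimed).
* `eulerFactor_deletion_exists_neg_all` — for EVERY prime `p` and every `K ≥ 1` the deletion of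
  the Euler factor of `p` truncated at `p^K` is non-positive (RH-free).

References: E. Bombieri, Rend. Lincei (9) 11 (2000) 183–233, §3; A. Weil (1952).
-/

set_option linter.dupNamespace false

noncomputable section

open Complex Set MeasureTheory
open scoped Real

namespace Summit.RiemannHypothesis.RiemannHypothesis.Theorems.PfPersistenceCoefficientRigidity

open Literature.NumberTheory.LFunctions
open Literature.NumberTheory.LFunctions.WeilConverse

/-! ## §22 The tower is a finitely-many-sites functional -/

/-- `tower_{μ,K,x₀} = W_{c,x}` with `E = {0,…,K-1}`, `c_k = μ_k`, `x_k = (k+1)x₀`. [this work] -/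
theorem towerQuadratic_eq_multiSiteQuadratic (μ : ℕ → ℝ) (K : ℕ) (x₀ : ℝ) (g : ℝ → ℂ) :
    towerQuadratic μ K x₀ g =
      multiSiteQuadratic (Finset.range K) μ (fun k : ℕ ↦ ((k + 1 : ℕ) : ℝ) * x₀) g :=
  rfl

/-- **Every non-trivial tower perturbation is non-positive (RH-free)**: for `x₀ > 0` and some
`μ_k ≠ 0` with `k < K` there is a test function with `Re tower_{μ,K,x₀}(g ⋆ g̃) < 0`.
[this work] -/
theorem exists_towerQuadratic_neg {μ : ℕ → ℝ} {K : ℕ} {x₀ : ℝ} (hx0 : 0 < x₀)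
    (hμ : ∃ k < K, μ k ≠ 0) :
    ∃ g : ℝ → ℂ, IsWeilTest g ∧ (towerQuadratic μ K x₀ g).re < 0 := by
  have hx : ∀ k ∈ Finset.range K, 0 < ((k + 1 : ℕ) : ℝ) * x₀ := fun k _ ↦ by positivity
  have hinj : Set.InjOn (fun k : ℕ ↦ ((k + 1 : ℕ) : ℝ) * x₀) (Finset.range K : Set ℕ) := by
    intro m _ n _ h
    have h' : ((m + 1 : ℕ) : ℝ) = ((n + 1 : ℕ) : ℝ) := mul_right_cancel₀ hx0.ne' h
    exact_mod_cast Nat.succ_injective (by exact_mod_cast h' : m + 1 = n + 1)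
  have hc : ∃ k ∈ Finset.range K, μ k ≠ 0 := by
    obtain ⟨k, hk, hne⟩ := hμ
    exact ⟨k, Finset.mem_range.2 hk, hne⟩
  simp_rw [towerQuadratic_eq_multiSiteQuadratic]
  exact exists_multiSiteQuadratic_neg hx hinj hc

/-- **Rigidity of the tower family**: for `x₀ > 0`,
`(∀ test g, Re tower_{μ,K,x₀}(g ⋆ g̃) ≥ 0) ↔ ((∀ k < K, μ_k = 0) ∧ RiemannHypothesis)`
(RH via Weil's criterion, imported; not claimed). [this work] -/
theorem towerQuadratic_nonneg_iff {μ : ℕ → ℝ} {K : ℕ} {x₀ : ℝ} (hx0 : 0 < x₀) :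
    (∀ g : ℝ → ℂ, IsWeilTest g → 0 ≤ (towerQuadratic μ K x₀ g).re) ↔
      (∀ k < K, μ k = 0) ∧ RiemannHypothesis := by
  have hx : ∀ k ∈ Finset.range K, 0 < ((k + 1 : ℕ) : ℝ) * x₀ := fun k _ ↦ by positivity
  have hinj : Set.InjOn (fun k : ℕ ↦ ((k + 1 : ℕ) : ℝ) * x₀) (Finset.range K : Set ℕ) := by
    intro m _ n _ h
    have h' : ((m + 1 : ℕ) : ℝ) = ((n + 1 : ℕ) : ℝ) := mul_right_cancel₀ hx0.ne' h
    exact_mod_cast Nat.succ_injective (by exact_mod_cast h' : m + 1 = n + 1)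
  simp_rw [towerQuadratic_eq_multiSiteQuadratic]
  rw [multiSiteQuadratic_nonneg_iff hx hinj]
  simp only [Finset.mem_range]

/-! ## §23 Every Euler-factor deletion -/

/-- **EVERY EULER-FACTOR DELETION IS NON-POSITIVE (RH-free, no threshold)**: for every prime `p`
and every `K ≥ 1`, deleting the Euler factor of `p` truncated at `p^K` (masses
`μ_k = log p/(√p)^{k+1}` at `± (k+1) log p`) from `ζ`'s explicit formula gives a functional
negative on some test function.  Part II had this only for `p ≥ N₀`. [this work] -/
theorem eulerFactor_deletion_exists_neg_all {p : ℕ} (hp : p.Prime) {K : ℕ} (hK : 1 ≤ K) :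
    ∃ g : ℝ → ℂ, IsWeilTest g ∧
      (towerQuadratic (fun k ↦ Real.log p / Real.sqrt p ^ (k + 1)) K (Real.log p) g).re < 0 := by
  have hp2 : (2 : ℝ) ≤ p := by exact_mod_cast hp.two_le
  have hlog : 0 < Real.log p := Real.log_pos (by linarith)
  have hsqrt : 0 < Real.sqrt p := Real.sqrt_pos.2 (by linarith)
  refine exists_towerQuadratic_neg hlog ⟨0, hK, ?_⟩
  exact div_ne_zero hlog.ne' (pow_ne_zero _ hsqrt.ne')

end Summit.RiemannHypothesis.RiemannHypothesis.Theorems.PfPersistenceCoefficientRigidity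

end
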